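import Summits.CriticalPhenomena.PercolationContinuityZ3.Theorems.Transplant.SiteUnfoldMain
import Summits.CriticalPhenomena.PercolationContinuityZ3.Theorems.Transplant.SiteLemmaT
import Summits.CriticalPhenomena.PercolationContinuityZ3.Theorems.Transplant.SiteS5Assembly
import HarnessLib

/-!
# SITE percolation: THEOREM 1 (the site conditioned slack hierarchy `SiteCSHAll`) ASSEMBLED — hence `SiteSurplusTransfer` ((S5)_site),
# `SiteAGloc`, `SiteAdditiveGluing` (site twin of the crux `AdditiveGluing`) and `SiteNearOneGluing` (SITE Kozma–Nitzan Conjecture 3),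
# UNCONDITIONALLY, on every finite graph with vertex weights (lane `prim-bschramm`, class C1a; P1-SITE-Z3 §12 WP7)

builds on p205010 (kernel theorem, internal audit signed; external expert review pending).

The three sockets of the site induction skeleton `SiteCSH.siteCSHAll_of_unfold` (p211724) are discharged:
* `hT` = site LEMMA T `SiteGibbs.siteCshMargin_nonneg_of_within` (the site two-cluster Gibbs sampler, files `SiteGibbsSampler/Covariance/LemmaT`);
* `hU` = site LEMMAS U + H `SiteCSH.siteWithin_nonneg_of_lower` (`SiteUnfoldMain`, with `SiteCovTau.siteHpart_nonneg`, p214548);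
* `hBase` = level zero (site MDL(X)) **`siteCshMargin_nil_nonneg`**, obtained here NOT by re-typing the bond T_A/HullPort chain but as site Lemma T at
  `k = 0` + site Lemma H at the marker set `S = {x}` (`within_nonneg_of_hpart` with the empty decoy list) — the site finite leg needs no separate MDL(X).
Consequences (all OURS — new theorems for the SITE model; the bond twins are the p205010 chain): **`siteCSHAll_holds`**, `siteSurplusTransfer_holds`,
`siteAGloc_holds`, **`siteAdditiveGluing_holds`**, **`siteNearOneGluing_holds`** (site Conjecture 3 of Kozma–Nitzan: for every `ε > 0` there is
`δ > 0` such that on every finite graph with vertex weights, `P(o ↔ A) > 1 − δ` and `P(a ↔ b) > 1 − δ` for all `a ∈ A` force `P(o ↔ b) > 1 − ε`),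
and `sitePercolationContinuityZ3_of_slab_inputs : SiteSlabPercolation → SiteBGN → SitePercolationContinuityZ3` (the C1a target modulo the two
site block-(D) inputs of `SiteTransplantThm6Skeleton`, p207372).  Census cover before proof: site AG/S5/GEN/CSH rows 0 violations through n ≤ 7
(ttrl engines A/B, standard + ε-pendant + light-pendant + heavy-star palettes).
Support file (`--supports stmt-CriticalPhenomena-4575 --as helper`); no definitions, no named facts, no sorries.
[cite: KozmaNitzan2024, Conj. 1 (p. 3), Conj. 3 (p. 15), Conj. 4 (p. 32)] [cite: VandenbergHaggstromKahn2005, §2.1 (pp. 9–13)]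
[cite: BenjaminiSchramm1996, Conj. 4]
-/

noncomputable section

namespace Summit.CriticalPhenomena.PercolationContinuityZ3.Theorems.Transplant

namespace SiteCSH

open MeasureTheory Set
open Literature.Probability.LatticeModels (prodBernoulli)
open Literature.Probability.Percolation
open Summit.CriticalPhenomena.PercolationContinuityZ3.Theorems.SiteTransplant (SiteAdditiveGluing SiteNearOneGluing SiteAGloc
  SiteSlabPercolation SiteBGN)
open SiteGen (SiteSurplusTransfer)
open scoped Classical

variable {n : ℕ} {Δ : SimpleGraph (Fin n)}

/-- **Level zero of the site hierarchy = site MDL(X)** (`0 ≤ covD_{x,Y}(f; o) − p·covD_{x,Y}(f; v)`, `p = μ(o↔v | v↮{x}∪Y)`), for non-degenerate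
vertex weights and every monotone `f`: site Lemma T at `k = 0` reduces it to the world-wise margin, which for the empty decoy list IS the H-part at
the marker set `{x}`, nonnegative by site Lemma H. [cite: VandenbergHaggstromKahn2005, §2.1 (pp. 9–13), Thm. 1.4 (p. 7)] -/
theorem siteCshMargin_nil_nonneg (q : Fin n → unitInterval) (hq : ∀ u, 0 < q u ∧ q u < 1) (x : Fin n) (Y : Set (Fin n))
    (o v : Fin n) (f : Set (Fin n) → ℝ) (hf : Monotone f) : 0 ≤ cshMargin Δ q x Y [] o v f := by
  refine SiteGibbs.siteCshMargin_nonneg_of_within q hq x Y [] o v (fun g hg hg0 => ?_) f hf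
  refine within_nonneg_of_hpart q hq x Y [] o v hg (fun pre d ds' h _ _ _ => ?_) ?_
  · simp at h
  · have hS : ((↑(insert x ([] : List (Fin n)).toFinset) : Set (Fin n)) ∪ Y) = insert x Y ∪ {d | d ∈ ([] : List (Fin n))} := by
      ext u
      simp only [List.toFinset_nil, insert_empty_eq, Finset.coe_singleton, singleton_union, mem_insert_iff, List.not_mem_nil,
        setOf_false, union_empty]
    have key := SiteCovTau.siteHpart_nonneg (Δ := Δ) q hq x Y (insert x ([] : List (Fin n)).toFinset) (Finset.mem_insert_self x _)
      o v g (fun C C' h => hg h) hg0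
    rw [hS] at key
    -- the two statements agree up to the (subsingleton) `DecidableEq` instance inside `List.toFinset`
    convert key using 20

/-- **SITE THEOREM 1 — the site conditioned slack hierarchy holds on every finite graph with non-degenerate vertex weights** (OURS).
[cite: VandenbergHaggstromKahn2005, §2.1 (pp. 9–13)] [cite: KozmaNitzan2024, Conj. 4 (p. 32)] -/
theorem siteCSHAll_holds : SiteCSHAll :=
  siteCSHAll_of_unfold fun _ _ q hq =>
    ⟨fun x Y o v _ f hf => siteCshMargin_nil_nonneg q hq x Y o v f hf,
      fun x Y D o v hW f hf => SiteGibbs.siteCshMargin_nonneg_of_within q hq x Y D o v hW f hf,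
      fun x Y D o v hxY ho hv hov hne hnd hdis hIH g hg hg0 =>
        siteWithin_nonneg_of_lower q hq x Y D o v hxY ho hv hov hne hnd hdis hIH g hg hg0⟩

/-- **(S5)_site — the site ranked surplus transfer — on every finite graph, all vertex weights and observers** (OURS).
[cite: KozmaNitzan2024, Conj. 4 (p. 32)] -/
theorem siteSurplusTransfer_holds : SiteSurplusTransfer :=
  siteSurplusTransfer_of_siteCSHAll siteCSHAll_holds

/-- **(AG-loc)_site, unconditionally** (OURS). [cite: KozmaNitzan2024, Conj. 1 (p. 3)] -/
theorem siteAGloc_holds : SiteAGloc :=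
  siteAGloc_of_siteCSHAll siteCSHAll_holds

/-- **SITE ADDITIVE GLUING, unconditionally** (OURS; the site twin of the crux `PercNearOneGluing.AdditiveGluing` of stmt-CriticalPhenomena-4576):
on every finite graph with vertex weights, `P(o ↮ b) ≤ P(o ↮ A) + max_{a ∈ A} P(a ↮ b)` for site connections (convention A).
[cite: KozmaNitzan2024, Conj. 1 (p. 3)] -/
theorem siteAdditiveGluing_holds : SiteAdditiveGluing :=
  siteAdditiveGluing_of_siteCSHAll siteCSHAll_holds

/-- **SITE KOZMA–NITZAN CONJECTURE 3, unconditionally** (OURS; `δ = ε/2`): the near-one gluing of site connection probabilities on every finite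
graph with vertex weights. [cite: KozmaNitzan2024, Conj. 3 (p. 15)] -/
theorem siteNearOneGluing_holds : SiteNearOneGluing :=
  siteNearOneGluing_of_siteCSHAll siteCSHAll_holds

/-- **The C1a target modulo the two site block-(D) inputs**: `SiteSlabPercolation → SiteBGN → θ^{site}_{ℤ³}(p_c^{site}) = 0` — the site finite
leg is now a theorem, so `SitePercolationContinuityZ3` rests exactly on the site KN §4 slab statement and the site half-space theorem
(`SiteTransplantThm6Skeleton`, p207372), or on the V18 back-end (site Theorem A + S1 ✓ + site D + M).
[cite: KozmaNitzan2024, Thm. 6 with Conj. 3 (p. 15)] [cite: BenjaminiSchramm1996, Conj. 4] -/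
theorem sitePercolationContinuityZ3_of_slab_inputs (hslab : SiteSlabPercolation) (hBGN : SiteBGN) : SitePercolationContinuityZ3 :=
  sitePercolationContinuityZ3_of_siteCSHAll hslab hBGN siteCSHAll_holds

end SiteCSH

end Summit.CriticalPhenomena.PercolationContinuityZ3.Theorems.Transplant
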